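import Summits.QuantumFields.YangMills.Theses.HyperbolicRegulator
import Summits.QuantumFields.YangMills.Theorems.HyperbolicRegulatorCurvatureUniformityRSplit
import Literature.Probability.LatticeModels.CoarseCellFiniteSize
import Literature.MathematicalPhysics.QuantumLattice.LatticeGaugeDLR

/-!
# Line `cone-tame-window-transfer` — crux `CurvatureUniformityR` (stmt-QuantumFields-18154), route `HyperbolicRegulator`

Registered skeleton (crux-strategist `planner-cstrat-stmt-QuantumFields-18154-b1-0`, 2026-08-17; card `Lines/cone-tame-window-transfer.md`;
census `STRATEGY-CENSUS.md` D0 + D2).  The crux is reached through the LANDED decomposition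
`ConeTameSplit.CurvatureUniformityR_of_subs : TameCoreUniformityR → ConeChartsOfAdmissible → CurvatureUniformityR`
(`Theorems/HyperbolicRegulatorCurvatureUniformityRSplit.lean`, p167706), and the tame core through the window-transfer line:

  stub_flatWindows      : FlatWindowsAtWeakCoupling                                   — the kernel K (weak-coupling volume-uniform gap in window currency); HARDEST
  stub_apexWindows      : ApexWindowsAtWeakCoupling                                   — K-type window at (cone apex) × (flat) blocks, intrinsic on cone-charted families
  stub_sparseIslands    : SparseIslandPathBound                                       — G-blind combinatorics, provable now (M)
  stub_graphCellEngine  : SparseIslandPathBound → GraphCellMixingEngine               — G-blind DS / disagreement engine on bounded-degree cell graphs with sparse wild cells, provable now (L)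
  stub_tameTransfer     : FlatWindows → ApexWindows → Engine → TameCoreUniformityR    — DLR bookkeeping through the Fam vocabulary (L)
  stub_coneCharts       : ConeChartsOfAdmissible                                      — G-free rigidity; BELIEVED FALSE (periscope cores, `Ideas/periscope-films.md`): the isolated exposure of the TYPED crux; if refuted, the parent is restated to TameCoreUniformityR and the other five stubs ARE the repaired crux's line
  CurvatureUniformityR_of : the crux BY NAME from the stubs by name; the `example` after it is the sorry-free glue in hypothesis form.
-/

set_option autoImplicit false

noncomputable section

namespace Summit.QuantumFields.YangMills.Cruxes.CurvatureUniformityR.ConeTameWindowTransfer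

open Classical
open MeasureTheory
open Literature.Probability.LatticeModels (Specification IsSpecification IsGibbsMeasure glueWith)
open Summit.QuantumFields.YangMills.Cruxes.CurvatureUniformityR.ConeTameSplit (TameCoreUniformityR ConeChartsOfAdmissible
  CurvatureUniformityR_of_subs)

/-! ## §1 Sparse wild islands do not spoil a subcritical path sum (first lemma of the line; G-blind) -/

/-- **Sparse-island path bound** (verbatim 15825 StrategistSketch §1). -/
def SparseIslandPathBound : Prop :=
  ∀ (V : Type) [Fintype V] [DecidableEq V] (Γ : SimpleGraph V) [DecidableRel Γ.Adj]
    (Δ D₀ R : ℕ) (W : Finset V) (w : V → ℝ) (ε : ℝ),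
    Γ.Connected →
    (∀ v, Γ.degree v ≤ Δ) →
    2 * D₀ < R →
    (∀ u ∈ W, ∀ v ∈ W, Γ.dist u v ≤ D₀ ∨ R ≤ Γ.dist u v) →
    0 < ε → ε ≤ 1 →
    (∀ v, 0 ≤ w v ∧ w v ≤ 1) → (∀ v, v ∉ W → w v ≤ ε) →
    let N₀ : ℕ := Δ ^ (D₀ + 1)
    let θ : ℝ := (Δ : ℝ) * ε ^ (1 - (N₀ : ℝ) / R)
    θ < 1 →
    ∀ x y : V,
      ∑ n ∈ Finset.range (Fintype.card V),
          ∑ p ∈ (Γ.finsetWalkLength n x y).filter (fun p => p.IsPath),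
            ∏ v ∈ p.support.toFinset, w v
        ≤ ε ^ (1 - (N₀ : ℝ)) * θ ^ Γ.dist x y / (1 - θ)

/-! ## §2 The kernel K in window currency (flat Dobrushin–Shlosman window for Wilson's specification on ℤ⁴) -/

open Literature.MathematicalPhysics.QuantumLattice in
/-- **Flat window** `W(β; L, n, ε)` (verbatim 15825 StrategistSketch §2). -/
def FlatWindow {G : Type} [Group G] [TopologicalSpace G] [IsTopologicalGroup G] [CompactSpace G]
    [MeasurableSpace G] [BorelSpace G] {N : ℕ} (ρ : G →* Matrix (Fin N) (Fin N) ℂ)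
    (β : ℝ) (L n : ℕ) (ε : ℝ) : Prop :=
  let cellOf : ZdEdge 4 → (Fin 4 → ℤ) := fun e i => e.1 i / (L : ℤ)
  ∀ A : Finset (ZdEdge 4),
    (∀ e ∈ A, ∀ i, |cellOf e i| ≤ (2 * n : ℤ)) →
    (∀ e e', cellOf e = cellOf e' → e ∈ A → e' ∈ A) →
    ∀ ζ ζ' : LGConfig 4 G, (∀ e, (∀ i, |cellOf e i| ≤ (2 * n : ℤ)) → ζ e = ζ' e) →
    ∀ f : LGConfig 4 G → ℝ, Measurable f → (∀ U, 0 ≤ f U ∧ f U ≤ 1) →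
      DependsOn f {e | cellOf e = 0} →
        |∫ U, f U ∂(ymSpecification (d := 4) ρ β A ζ) - ∫ U, f U ∂(ymSpecification (d := 4) ρ β A ζ')|
          ≤ ε

open Literature.MathematicalPhysics.QuantumFieldTheory in
/-- **stub_flatWindows — flat windows at every weak coupling** (the kernel K; hardest stub; false for U(1)). -/
def FlatWindowsAtWeakCoupling : Prop :=
  ∀ (G : Type) [Group G] [TopologicalSpace G] [IsTopologicalGroup G] [CompactSpace G],
    IsCompactSimpleLieGroup G → letI : MeasurableSpace G := borel G; haveI : BorelSpace G := ⟨rfl⟩;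
    ∀ r : LatticeRep G, ∃ β₁ : ℝ, ∀ β : ℝ, β₁ ≤ β → ∃ (L n : ℕ) (ε : ℝ), 0 < L ∧ 0 ≤ ε ∧
      ε * (((4 * n + 3) ^ 4 - (4 * n + 1) ^ 4 : ℕ) : ℝ) ≤ 3 / 4 ∧ FlatWindow r.ρ β L n ε

/-! ## §3 Finite-size mixing on a CELL GRAPH with sparse wild cells (the engine; G-blind) -/

section Engine

variable {ι V S : Type*} [MeasurableSpace S]

/-- **Good-exterior finite-size condition on a cell graph, worst case on TAME cells.**  Cells are labelled by the vertices of a graph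
`Γc` (replacing the tree's coarse torus `CoarseIdx μ` and its `ℓ^∞` distance by `Γc.dist`); for every tame cell `c`, every cell-union `A`
inside the ball of radius `2n` around `c`, every two exterior data agreeing on that ball, and every `[0,1]`-valued measurable observable of the
cell `c`, the kernel expectations differ by at most `ε`.  Wild cells carry no condition. -/
structure IsGoodFSGraph [Fintype V] (Γc : SimpleGraph ι) (cell : V → ι) (γ : Specification V S)
    (tame : Set ι) (n : ℕ) (ε : ℝ) : Prop where
  fs : ∀ c ∈ tame, ∀ (A : Finset V), (∀ v ∈ A, Γc.dist c (cell v) ≤ 2 * n) →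
    (∀ v w, cell v = cell w → v ∈ A → w ∈ A) →
    ∀ ζ ζ' : V → S, (∀ v, Γc.dist c (cell v) ≤ 2 * n → ζ v = ζ' v) →
      ∀ f : (V → S) → ℝ, Measurable f → (∀ σ, 0 ≤ f σ ∧ f σ ≤ 1) → DependsOn f {v | cell v = c} →
        |∫ σ, f σ ∂(γ A ζ) - ∫ σ, f σ ∂(γ A ζ')| ≤ ε

/-- **Cell-Markov specification**: the kernel of a cell-union `A` does not see exterior data beyond the cells adjacent to `A` (Wilson's action
couples neighbouring cells only, once cells have side `≥ 1`). -/
def IsCellMarkov [Fintype V] (Γc : SimpleGraph ι) (cell : V → ι) (γ : Specification V S) : Prop :=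
  ∀ (A : Finset V), (∀ v w, cell v = cell w → v ∈ A → w ∈ A) →
    ∀ ζ ζ' : V → S, (∀ v, (∃ a ∈ A, Γc.dist (cell a) (cell v) ≤ 1) → ζ v = ζ' v) →
      ∀ f : (V → S) → ℝ, Measurable f → (∃ B, ∀ σ, |f σ| ≤ B) → ∫ σ, f σ ∂(γ A ζ) = ∫ σ, f σ ∂(γ A ζ')

end Engine

/-- **stub_graphCellEngine — the disagreement / finite-size engine on a bounded-degree cell graph with sparse wild cells.**  For maximal cell
degree `Δ`, window `n` and island diameter `D₀` there are a threshold `ε₀ > 0` and a separation `R₀` such that for every `R ≥ R₀` there are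
`θ < 1`, `C` with: on every finite connected cell graph of degree `≤ Δ`, every cell-Markov specification with worst-case windows `(n, ε ≤ ε₀)`
on the tame cells and `(D₀, R)`-sparse wild cells, EVERY Gibbs measure has `|cov(f, g)| ≤ C ‖f‖ ‖g‖ |Δf| θ^D` for bounded measurable cell-local
observables whose cell supports are at graph distance `≥ D`.  Template: tree `defectFree_mixing` (coarse torus, no wild cells) and
`influence_decay_markov_defects` (random rare defects); here defects are deterministic and sparse, and the crude path count `Δ^n` of
`SparseIslandPathBound` is what the smallness of `ε` pays for (non-amenable growth of the cell graph is irrelevant). -/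
def GraphCellMixingEngine : Prop :=
  ∀ (Δ n D₀ : ℕ), ∃ ε₀ : ℝ, 0 < ε₀ ∧ ∃ R₀ : ℕ, ∀ R : ℕ, R₀ ≤ R → ∃ θ C : ℝ, 0 < θ ∧ θ < 1 ∧ 0 ≤ C ∧
    ∀ (ι V S : Type) [Fintype ι] [DecidableEq ι] [Fintype V] [MeasurableSpace S]
      (Γc : SimpleGraph ι) [DecidableRel Γc.Adj] (cell : V → ι) (γ : Specification V S) (tame : Finset ι) (ε : ℝ),
      Γc.Connected → (∀ c, Γc.degree c ≤ Δ) → IsSpecification γ → IsCellMarkov Γc cell γ →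
      0 ≤ ε → ε ≤ ε₀ → IsGoodFSGraph Γc cell γ (↑tame) n ε →
      (∀ u, u ∉ tame → ∀ u', u' ∉ tame → Γc.dist u u' ≤ D₀ ∨ R ≤ Γc.dist u u') →
      ∀ ν : Measure (V → S), IsGibbsMeasure γ ν →
      ∀ (f g : (V → S) → ℝ) (Δf Δg : Finset ι) (Bf Bg : ℝ) (D : ℕ),
        Measurable f → Measurable g → (∀ σ, |f σ| ≤ Bf) → (∀ σ, |g σ| ≤ Bg) →
        DependsOn f {v | cell v ∈ Δf} → DependsOn g {v | cell v ∈ Δg} →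
        (∀ x ∈ Δf, ∀ x' ∈ Δg, D ≤ Γc.dist x x') →
          |∫ σ, f σ * g σ ∂ν - (∫ σ, f σ ∂ν) * ∫ σ, g σ ∂ν| ≤ C * Bf * Bg * Δf.card * θ ^ D

/-! ## §4 Apex windows, intrinsic on cone-charted admissible families (K-type; the one extra local physical claim of the line) -/

/-- **stub_apexWindows.**  For every compact simple `G` and faithful `r` there is `β₁` such that for every `β ≥ β₁` and every `ε > 0` there
are a block radius `ℓ` and a window `n` with: for every cone-charted admissible complex with `64 n ℓ ≤ k`, every cone `c` of `S`, every vertex `y`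
of `S′` farther than `4 n ℓ` from all cones (so the second factor is flat `ℤ²` throughout the window), every edge set `A` inside the product-metric
ball of radius `2 n ℓ` around `(c, y)`, every two exterior configurations agreeing on that ball and every `[0,1]`-valued measurable observable of
the `ℓ`-ball, the conditional kernels `γ_A(f | ζ)`, `γ_A(f | ζ')` of the family's Wilson measure (product Haar on `A` glued with `ζ`, tilted by
`β S`) differ by at most `ε`.  The `let Fam`, `let CC` preambles are byte-identical to `TameCoreUniformityR`'s; `Spec` re-inlines the edge set,
configurations, product Haar and action `S` and adds the edge position map, the product graph metric, its balls and the kernels. -/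
def ApexWindowsAtWeakCoupling : Prop :=
  open Literature.MathematicalPhysics.QuantumFieldTheory Literature.MathematicalPhysics.QuantumLattice MeasureTheory in ∀ (G : Type) [Group G] [TopologicalSpace G] [IsTopologicalGroup G] [CompactSpace G], IsCompactSimpleLieGroup G → letI : MeasurableSpace G := borel G; haveI : BorelSpace G := ⟨rfl⟩; ∀ r : LatticeRep G, let Fam := fun (k j : ℕ) (V E Q : Finset ℕ) (σ τ : ℕ → ℕ) (bd : ℕ → Fin 4 → ℕ × Bool) (cV : ℕ → ℤ × ℤ → ℕ) (cE : ℕ → ℤ × ℤ → Fin 2 → ℕ × Bool) => let st := fun e : ℕ × Bool => if e.2 then σ e.1 else τ e.1; let en := fun e : ℕ × Bool => if e.2 then τ e.1 else σ e.1; let Γ := SimpleGraph.fromRel fun a b : ℕ => ∃ e ∈ E, σ e = a ∧ τ e = b; let dg := fun x : ℕ => (E.filter fun e => σ e = x ∨ τ e = x).card; let K := V.filter fun x => dg x = 5; let F := fun x : ℕ => x ∈ V ∧ ∀ c ∈ K, k / 2 < Γ.dist x c; let Dp := fun x : ℕ => x ∈ V ∧ ∀ c ∈ K, 3 * (k / 4)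 < Γ.dist x c; let ib := fun a : ℤ × ℤ => |a.1| ≤ (k : ℤ) / 4 ∧ |a.2| ≤ (k : ℤ) / 4; let nx := fun (a : ℤ × ℤ) (μ : Fin 2) => if μ = 0 then (a.1 + 1, a.2) else (a.1, a.2 + 1); let Ed := (ℕ × ℕ) ⊕ (ℕ × ℕ); let PE : Finset Ed := (E ×ˢ V).disjSum (V ×ˢ E); let Cfg := ↥PE → G; let ν := Measure.pi fun _ : ↥PE => haarProbability G; let v := fun (U : Cfg) (e : Ed × Bool) => if h : e.1 ∈ PE then (if e.2 then U ⟨e.1, h⟩ else (U ⟨e.1, h⟩)⁻¹) else 1; let w := fun (U : Cfg) (e : Fin 4 → Ed × Bool) => (r.ρ (v U (e 0) * v U (e 1) * v U (e 2) * v U (e 3))).trace.re; let S := fun U : Cfg => (∑ q ∈ Q, ∑ y ∈ V, w U fun i => (Sum.inl ((bd q i).1, y), (bd q i).2)) + (∑ y ∈ V, ∑ q ∈ Q, w U fun i => (Sum.inr (y, (bd q i).1), (bd q i).2)) + ∑ e ∈ E, ∑ e' ∈ E, w U ![(Sum.inl (e, σ e'), true), (Sum.inr (τ e, e'), true), (Sum.inl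 (e, τ e'), false), (Sum.inr (σ e, e'), false)]; let d0 : Fin 4 → Fin 2 := ![0, 1, 0, 1]; let P := fun (x x' : ℕ) (U : Cfg) (p : ZdEdge 4) => let a := (p.1 0, p.1 1); let b := (p.1 2, p.1 3); if p.2 = 0 ∨ p.2 = 1 then v U (Sum.inl ((cE x a (d0 p.2)).1, cV x' b), (cE x a (d0 p.2)).2) else v U (Sum.inr (cV x a, (cE x' b (d0 p.2)).1), (cE x' b (d0 p.2)).2); ((∀ e ∈ E, σ e ∈ V ∧ τ e ∈ V ∧ σ e ≠ τ e) ∧ (∀ q ∈ Q, (∀ i, (bd q i).1 ∈ E) ∧ (∀ i, en (bd q i) = st (bd q (i + 1))) ∧ (st ∘ bd q).Injective) ∧ (∀ e ∈ E, (Q.filter fun q => ∃ i, (bd q i).1 = e).card = 2) ∧ (∀ x ∈ V, (dg x = 4 ∨ dg x = 5) ∧ (Q.filter fun q => ∃ i, st (bd q i) = x).card = dg x) ∧ (∀ x ∈ V, ∃ c ∈ K, Γ.dist x c ≤ k) ∧ (∀ c ∈ K, ∀ c' ∈ K, c ≠ c' → k ≤ Γ.dist c c') ∧ (∀ f : ℕ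 → ℝ, ∑ x ∈ V, f x = 0 → ∑ x ∈ V, f x ^ 2 ≤ 10 ^ 6 * (k : ℝ) ^ 2 * ∑ e ∈ E, (f (σ e) - f (τ e)) ^ 2) ∧ (∃ x y, Dp x ∧ Dp y ∧ j ≤ Γ.dist x y) ∧ (∀ x, F x → cV x (0, 0) = x ∧ (∀ a, ib a → cV x a ∈ V) ∧ Set.InjOn (cV x) {a | ib a} ∧ (∀ a μ, ib a → ib (nx a μ) → (cE x a μ).1 ∈ E ∧ st (cE x a μ) = cV x a ∧ en (cE x a μ) = cV x (nx a μ)) ∧ (∀ a, ib a → ib (a.1 + 1, a.2 + 1) → ∃ q ∈ Q, Finset.univ.image (Prod.fst ∘ bd q) = {(cE x a 0).1, (cE x (nx a 0) 1).1, (cE x (nx a 1) 0).1, (cE x a 1).1})), fun (β m C : ℝ) (A B : YMSpecies G) => let X := fun f : Cfg → ℝ => (∫ U, f U * Real.exp (β * S U) ∂ν) / (∫ U, Real.exp (β * S U) ∂ν); ∀ x x' y y', F x → F x' → F y → F y' → |X (fun U => A.F (P x x' U) * B.F (P y y' U)) - X (fun U => A.F (P x x' U)) * X (fun U => B.F (P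 y y' U))| ≤ C * Real.exp (-(m * ((Γ.dist x y + Γ.dist x' y' : ℕ) : ℝ)))); let Sp := fun (A : YMSpecies G) (R : ℕ) => ∀ p ∈ A.supp, ∀ i, |p.1 i| ≤ (R : ℤ); let CC := fun (k : ℕ) (V E Q : Finset ℕ) (σ τ : ℕ → ℕ) (bd : ℕ → Fin 4 → ℕ × Bool) (cK : ℕ → Fin 5 → ℕ × ℕ → ℕ) => let st := fun e : ℕ × Bool => if e.2 then σ e.1 else τ e.1; let Γ := SimpleGraph.fromRel fun a b : ℕ => ∃ e ∈ E, σ e = a ∧ τ e = b; let dg := fun x : ℕ => (E.filter fun e => σ e = x ∨ τ e = x).card; let K := V.filter fun x => dg x = 5; let R := k / 2; let P := fun (c : ℕ) (s : Fin 5) (a b : ℕ) => if a = 0 ∧ b = 0 then c else if a = 0 then cK c (s + 1) (b, 0) else cK c s (a, b); ∀ c ∈ K, (∀ (s : Fin 5) (a b : ℕ), a ≤ R → b ≤ R → P c s a b ∈ V) ∧ (∀ (s : Fin 5) (a b : ℕ), 1 ≤ a → a ≤ R → b ≤ R → cK c s (a, b) ≠ c) ∧ (∀ (s s' : Fin 5)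 (a a' b b' : ℕ), 1 ≤ a → a ≤ R → b ≤ R → 1 ≤ a' → a' ≤ R → b' ≤ R → cK c s (a, b) = cK c s' (a', b') → s = s' ∧ a = a' ∧ b = b') ∧ (∀ (s : Fin 5) (a b : ℕ), a + 1 ≤ R → b ≤ R → Γ.Adj (P c s a b) (P c s (a + 1) b)) ∧ (∀ (s : Fin 5) (a b : ℕ), a ≤ R → b + 1 ≤ R → Γ.Adj (P c s a b) (P c s a (b + 1))) ∧ (∀ (s : Fin 5) (a b : ℕ), a + 1 ≤ R → b + 1 ≤ R → ∃ q ∈ Q, Finset.univ.image (st ∘ bd q) = {P c s a b, P c s (a + 1) b, P c s a (b + 1), P c s (a + 1) (b + 1)}) ∧ (∀ x ∈ V, Γ.dist x c ≤ R → ∃ (s : Fin 5) (a b : ℕ), a + b ≤ R ∧ P c s a b = x); let Spec := fun (k j : ℕ) (V E Q : Finset ℕ) (σ τ : ℕ → ℕ) (bd : ℕ → Fin 4 → ℕ × Bool) (β : ℝ) => let st := fun e : ℕ × Bool => if e.2 then σ e.1 else τ e.1; let en := fun e : ℕ × Bool => if e.2 then τ e.1 else σ e.1; let Γ := SimpleGraph.fromRel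 fun a b : ℕ => ∃ e ∈ E, σ e = a ∧ τ e = b; let dg := fun x : ℕ => (E.filter fun e => σ e = x ∨ τ e = x).card; let K := V.filter fun x => dg x = 5; let F := fun x : ℕ => x ∈ V ∧ ∀ c ∈ K, k / 2 < Γ.dist x c; let Dp := fun x : ℕ => x ∈ V ∧ ∀ c ∈ K, 3 * (k / 4) < Γ.dist x c; let ib := fun a : ℤ × ℤ => |a.1| ≤ (k : ℤ) / 4 ∧ |a.2| ≤ (k : ℤ) / 4; let nx := fun (a : ℤ × ℤ) (μ : Fin 2) => if μ = 0 then (a.1 + 1, a.2) else (a.1, a.2 + 1); let Ed := (ℕ × ℕ) ⊕ (ℕ × ℕ); let PE : Finset Ed := (E ×ˢ V).disjSum (V ×ˢ E); let Cfg := ↥PE → G; let ν := Measure.pi fun _ : ↥PE => haarProbability G; let v := fun (U : Cfg) (e : Ed × Bool) => if h : e.1 ∈ PE then (if e.2 then U ⟨e.1, h⟩ else (U ⟨e.1, h⟩)⁻¹) else 1; let w := fun (U : Cfg) (e : Fin 4 → Ed × Bool) => (r.ρ (v U (e 0) * v U (e 1) * v U (e 2) * v U (e 3))).trace.re; let S :=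 fun U : Cfg => (∑ q ∈ Q, ∑ y ∈ V, w U fun i => (Sum.inl ((bd q i).1, y), (bd q i).2)) + (∑ y ∈ V, ∑ q ∈ Q, w U fun i => (Sum.inr (y, (bd q i).1), (bd q i).2)) + ∑ e ∈ E, ∑ e' ∈ E, w U ![(Sum.inl (e, σ e'), true), (Sum.inr (τ e, e'), true), (Sum.inl (e, τ e'), false), (Sum.inr (σ e, e'), false)]; let pos := fun e : Ed => Sum.elim (fun p : ℕ × ℕ => (σ p.1, p.2)) (fun p : ℕ × ℕ => (p.1, σ p.2)) e; let pd := fun (a b : ℕ × ℕ) => Γ.dist a.1 b.1 + Γ.dist a.2 b.2; let Bl := fun (z : ℕ × ℕ) (R : ℕ) (e : ↥PE) => pd (pos e.1) z ≤ R; let γ := fun (A : Finset ↥PE) (ζ : Cfg) => ((Measure.pi fun _ : ↥A => haarProbability G).map (fun u => Literature.Probability.LatticeModels.glueWith A u ζ)).tilted fun U => β * S U; (K, Γ, Bl, γ); ∃ β₁ : ℝ, ∀ β, β₁ ≤ β → ∀ ε : ℝ, 0 < ε → ∃ ℓ n : ℕ, 0 < ℓ ∧ ∀ (k j : ℕ)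 (V E Q : Finset ℕ) (σ τ : ℕ → ℕ) (bd : ℕ → Fin 4 → ℕ × Bool) (cV : ℕ → ℤ × ℤ → ℕ) (cE : ℕ → ℤ × ℤ → Fin 2 → ℕ × Bool) (cK : ℕ → Fin 5 → ℕ × ℕ → ℕ), 64 * n * ℓ ≤ k → (Fam k j V E Q σ τ bd cV cE).1 → CC k V E Q σ τ bd cK → ∀ c ∈ (Spec k j V E Q σ τ bd β).1, ∀ y ∈ V, (∀ c' ∈ (Spec k j V E Q σ τ bd β).1, 4 * n * ℓ < ((Spec k j V E Q σ τ bd β).2.1).dist y c') → ∀ A : Finset ↥((E ×ˢ V).disjSum (V ×ˢ E)), (∀ e ∈ A, (Spec k j V E Q σ τ bd β).2.2.1 (c, y) (2 * n * ℓ) e) → ∀ ζ ζ' : ↥((E ×ˢ V).disjSum (V ×ˢ E)) → G, (∀ e, (Spec k j V E Q σ τ bd β).2.2.1 (c, y) (2 * n * ℓ) e → ζ e = ζ' e) → ∀ f : (↥((E ×ˢ V).disjSum (V ×ˢ E)) → G) → ℝ, Measurable f → (∀ U, 0 ≤ f U ∧ f U ≤ 1) → DependsOn f {e | (Spec k j V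 E Q σ τ bd β).2.2.1 (c, y) ℓ e} → |(∫ U, f U ∂((Spec k j V E Q σ τ bd β).2.2.2 A ζ)) - ∫ U, f U ∂((Spec k j V E Q σ τ bd β).2.2.2 A ζ')| ≤ ε


/-! ## §5 Registered stubs and the composition -/

/-- **stub_flatWindows** — the kernel K in window currency (hardest stub; (G,d)-sensitive; false for U(1)). -/
theorem stub_flatWindows : FlatWindowsAtWeakCoupling := by
  sorry

/-- **stub_apexWindows** — apex × flat windows, intrinsic (K-type; the line's one extra local physical claim). -/
theorem stub_apexWindows : ApexWindowsAtWeakCoupling := by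
  sorry

/-- **stub_sparseIslands** — G-blind combinatorics of (D₀,R)-sparse wild islands (provable now). -/
theorem stub_sparseIslands : SparseIslandPathBound := by
  sorry

/-- **stub_graphCellEngine** — the finite-size / disagreement engine on bounded-degree cell graphs with sparse wild cells, from the path bound
(template: tree `defectFree_mixing`; provable now). -/
theorem stub_graphCellEngine : SparseIslandPathBound → GraphCellMixingEngine := by
  sorry

/-- **stub_tameTransfer** — windows + engine ⇒ the tame core: cells of side `ℓ` read in flat and cone charts, the family's Wilson measure as
the unique Gibbs measure of its cell-Markov specification, chart-read observables cell-local, corners `core(c) × core(c′)` as the sparse wild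
cells (`R ≍ k/ℓ`), rate `m = −log θ/ℓ`, constants free of `k`, `K(β) ≍ 64 n ℓ R₀`. -/
theorem stub_tameTransfer :
    FlatWindowsAtWeakCoupling → ApexWindowsAtWeakCoupling → GraphCellMixingEngine → TameCoreUniformityR := by
  sorry

/-- **stub_coneCharts** — every admissible complex admits cone charts.  BELIEVED FALSE (periscope cores); the isolated exposure of the typed
crux (see the line card); a disprover target as much as a stub. -/
theorem stub_coneCharts : ConeChartsOfAdmissible := by
  sorry

/-- **Composition** — the crux BY NAME from the six stubs BY NAME, through the landed split (the `sorry`s live only inside the stubs). -/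
theorem CurvatureUniformityR_of : Summit.QuantumFields.YangMills.Theses.HyperbolicRegulator.CurvatureUniformityR :=
  CurvatureUniformityR_of_subs (stub_tameTransfer stub_flatWindows stub_apexWindows (stub_graphCellEngine stub_sparseIslands))
    stub_coneCharts

/-- **The glue alone, `sorry`-free** (hypothesis form: the six stub STATEMENTS give the crux; this `example` does not mention the stubs). -/
example (h₁ : FlatWindowsAtWeakCoupling) (h₂ : ApexWindowsAtWeakCoupling) (h₃ : SparseIslandPathBound)
    (h₄ : SparseIslandPathBound → GraphCellMixingEngine)
    (h₅ : FlatWindowsAtWeakCoupling → ApexWindowsAtWeakCoupling → GraphCellMixingEngine → TameCoreUniformityR)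
    (h₆ : ConeChartsOfAdmissible) :
    Summit.QuantumFields.YangMills.Theses.HyperbolicRegulator.CurvatureUniformityR :=
  CurvatureUniformityR_of_subs (h₅ h₁ h₂ (h₄ h₃)) h₆

end Summit.QuantumFields.YangMills.Cruxes.CurvatureUniformityR.ConeTameWindowTransfer
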